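import Literature.NumberTheory.LFunctions.CertifiedDirichletLTuringRealSignChanges
import Literature.NumberTheory.LFunctions.TuringMethodTrudgianNumericsCheck
import HarnessLib

/-!
# Turing's method for a real primitive character from sign-change data — hypothesis-free forms
# (COMPUTATIONAL lane: the `ζ`-numerics certificate `trudgianCheck = true` discharged by `native_decide`)

Topic `Literature/NumberTheory/LFunctions`; namespace `Literature.NumberTheory.LFunctions`.  The kernel-lane file
`CertifiedDirichletLTuringRealSignChanges.lean` proves the sign-change / F-point certificate schemas for a real
primitive character granted the hypothesis `TrudgianNumerics.trudgianCheck = true` (the tree's certified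
Euler–Maclaurin evaluation of the `ζ`-quantities in Trudgian's constants `2.26`, `0.0642`).  Here that hypothesis
is discharged by `TrudgianNumerics.trudgianCheck_eq_true` (`TuringMethodTrudgianNumericsCheck.lean`,
`native_decide`: this file's theorems depend on the auxiliary axiom
`TrudgianNumerics.trudgianCheck_eq_true._native.native_decide.ax_1_1`, i.e. trust in the Lean compiler, exactly
as `LFunctionRHUpTo.of_turing_numeric'` / `TuringDirichlet.abs_integral_lfunctionArgS_le_numeric`).  What remains
for a certificate of `LFunctionRHUpTo χ T` (`χ` real primitive, conductor `q ∈ {3, 4, 5, 7, 8}` or any `q > 1`):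
sign-change data for `ξ(½ + it, χ)` on `[0, T]` and inside `(T, T + h]`, an enclosure of `∫_T^{T+h} θ(t, χ) dt`,
and ONE decimal comparison.

* `LFunctionRHUpTo.of_turing_signChanges_numeric`, `of_turing_FPoints_numeric`, `of_turing_FPointLists_numeric` —
  general `q` (HIK sign-change intervals / Rumely F-point lists);
* `LFunctionRHUpTo.of_turing_mod3 / _mod4 / _mod5 / _mod7 / _mod8` — the five smallest conductors (Rumely 1993
  Table 5.5 targets: `46 / 50 / 54 / 59 / 61` zeros below `T = 100`, …; `RumelyZeroTablesSmallConductors.lean`).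

## References
* R. Rumely, Numerical computations concerning the ERH, Math. Comp. 61 (1993), §3 Proposition 3 p. 428;
  Supplement Table 5.5 p. S20. [Rumely1993ERH]
* D. J. Platt, Math. Comp. 85 (2016), Theorem 3.2. [Platt2016GRH]
* T. S. Trudgian, Math. Comp. 80 (2011), Theorem 3.3 / §3.5. [Trudgian2011]
-/

noncomputable section

open Complex Set MeasureTheory intervalIntegral
open scoped Real

namespace Literature.NumberTheory.LFunctions

open DirichletCharacter ExplicitPsiChar DirichletTheta HiaryIrelandKyi2026 TrudgianNumerics TuringDirichlet

variable {q : ℕ} [NeZero q] {χ : DirichletCharacter ℂ q}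

/-- **Sign-change certificate, hypothesis-free** (computational lane): for a quadratic primitive `χ` mod
`q > 1`, `T > 50`, `h > 0`, sign-change data `𝒵₁ ⊆ [0, T]`, `𝒵₂ ⊆ (T, T+h]` and
`2(2.26 + 0.0642 log(q(T+h)/2π)) + (2/π)∫_T^{T+h} θ − 2Σ_{𝒵₂}(T+h−b) < h(2#𝒵₁ + 1)` give
`LFunctionRHUpTo χ T ∧ N_χ(T) = N_{χ,0}(T) = 2#𝒵₁`. [cite: Rumely1993ERH, §3 Proposition 3 p. 428]
[cite: Platt2016GRH, Theorem 3.2] -/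
theorem LFunctionRHUpTo.of_turing_signChanges_numeric
    (hχ : χ.IsPrimitive) (hχ2 : χ.IsQuadratic) (hq : 1 < q) {T h : ℝ} (hT : 50 < T) (hh : 0 < h)
    {Z₁ : Finset (ℝ × ℝ)} (hZ₁ : IsSignChangeData χ T Z₁)
    {Z₂ : Finset (ℝ × ℝ)} (hZ₂ : IsSignChangeData χ (T + h) Z₂) (hZ₂T : ∀ P ∈ Z₂, T < P.1)
    (hnum : 2 * (2.26 + 0.0642 * Real.log (q * (T + h) / (2 * π))) +
        2 / π * (∫ t in T..T + h, lfunctionTheta χ t) - 2 * ∑ P ∈ Z₂, (T + h - P.2) <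
        h * (2 * Z₁.card + 1)) :
    LFunctionRHUpTo χ T ∧ lfunctionZeroCount χ T = 2 * Z₁.card ∧
      lfunctionCriticalZeroCount χ T = 2 * Z₁.card :=
  LFunctionRHUpTo.of_turing_signChanges' trudgianCheck_eq_true hχ hχ2 hq hT hh hZ₁ hZ₂ hZ₂T hnum

/-- **F-point certificate, hypothesis-free** (computational lane): `0 ≤ t₀ < ⋯ < t_m ≤ T` with
`Re ξ(½+it_{i−1},χ)·Re ξ(½+it_i,χ) < 0`, sign-change data `𝒵₂ ⊆ (T, T+h]`, `T > 50`, `h > 0`, and the decimal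
inequality with `h(2m + 1)` give `LFunctionRHUpTo χ T ∧ N_χ(T) = N_{χ,0}(T) = 2m`.
[cite: Rumely1993ERH, §3 Proposition 3 p. 428] [cite: Platt2016GRH, Theorem 3.2] -/
theorem LFunctionRHUpTo.of_turing_FPoints_numeric
    (hχ : χ.IsPrimitive) (hχ2 : χ.IsQuadratic) (hq : 1 < q) {T h : ℝ} (hT : 50 < T) (hh : 0 < h)
    {m : ℕ} {t : ℕ → ℝ} (ht0 : 0 ≤ t 0) (hmono : ∀ i < m, t i < t (i + 1))
    (halt : ∀ i < m, (dirichletXi χ (1 / 2 + t i * I)).re * (dirichletXi χ (1 / 2 + t (i + 1) * I)).re < 0)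
    (htm : t m ≤ T)
    {Z₂ : Finset (ℝ × ℝ)} (hZ₂ : IsSignChangeData χ (T + h) Z₂) (hZ₂T : ∀ P ∈ Z₂, T < P.1)
    (hnum : 2 * (2.26 + 0.0642 * Real.log (q * (T + h) / (2 * π))) +
        2 / π * (∫ t in T..T + h, lfunctionTheta χ t) - 2 * ∑ P ∈ Z₂, (T + h - P.2) <
        h * (2 * m + 1)) :
    LFunctionRHUpTo χ T ∧ lfunctionZeroCount χ T = 2 * m ∧ lfunctionCriticalZeroCount χ T = 2 * m :=
  LFunctionRHUpTo.of_turing_FPoints trudgianCheck_eq_true hχ hχ2 hq hT hh ht0 hmono halt htm hZ₂ hZ₂T hnum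


/-- **F-point lists below and above `T`, hypothesis-free** (computational lane): `0 ≤ t₀ < ⋯ < t_m ≤ T`,
`T ≤ u₀ < ⋯ < u_k ≤ T + h`, alternating signs of `Re ξ(½ + i·, χ)` along each list, `T > 50`, `h > 0`, and
`2(2.26 + 0.0642 log(q(T+h)/2π)) + (2/π)∫_T^{T+h} θ − 2Σ_{j=1}^{k}(T+h−u_j) < h(2m + 1)` give
`LFunctionRHUpTo χ T ∧ N_χ(T) = N_{χ,0}(T) = 2m`. [cite: Rumely1993ERH, §3 Proposition 3 p. 428]
[cite: Platt2016GRH, Theorem 3.2] -/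
theorem LFunctionRHUpTo.of_turing_FPointLists_numeric
    (hχ : χ.IsPrimitive) (hχ2 : χ.IsQuadratic) (hq : 1 < q) {T h : ℝ} (hT : 50 < T) (hh : 0 < h)
    {m : ℕ} {t : ℕ → ℝ} (ht0 : 0 ≤ t 0) (htmono : ∀ i < m, t i < t (i + 1))
    (htalt : ∀ i < m, (dirichletXi χ (1 / 2 + t i * I)).re * (dirichletXi χ (1 / 2 + t (i + 1) * I)).re < 0)
    (htm : t m ≤ T)
    {k : ℕ} {u : ℕ → ℝ} (hu0 : T ≤ u 0) (humono : ∀ j < k, u j < u (j + 1))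
    (hualt : ∀ j < k, (dirichletXi χ (1 / 2 + u j * I)).re * (dirichletXi χ (1 / 2 + u (j + 1) * I)).re < 0)
    (huk : u k ≤ T + h)
    (hnum : 2 * (2.26 + 0.0642 * Real.log (q * (T + h) / (2 * π))) +
        2 / π * (∫ t in T..T + h, lfunctionTheta χ t) - 2 * ∑ j ∈ Finset.range k, (T + h - u (j + 1)) <
        h * (2 * m + 1)) :
    LFunctionRHUpTo χ T ∧ lfunctionZeroCount χ T = 2 * m ∧ lfunctionCriticalZeroCount χ T = 2 * m :=
  LFunctionRHUpTo.of_turing_FPointLists trudgianCheck_eq_true hχ hχ2 hq hT hh ht0 htmono htalt htm hu0 humono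
    hualt huk hnum

/-- **Conductor `3`, hypothesis-free** (`(−3/·)`; Table 5.5 `Q = 3`). [cite: Rumely1993ERH, Supplement Table 5.5 (Q = 3)] -/
theorem LFunctionRHUpTo.of_turing_mod3 {χ : DirichletCharacter ℂ 3} (hχ : χ.IsPrimitive)
    {T h : ℝ} (hT : 50 < T) (hh : 0 < h)
    {Z₁ : Finset (ℝ × ℝ)} (hZ₁ : IsSignChangeData χ T Z₁)
    {Z₂ : Finset (ℝ × ℝ)} (hZ₂ : IsSignChangeData χ (T + h) Z₂) (hZ₂T : ∀ P ∈ Z₂, T < P.1)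
    (hnum : 2 * (2.26 + 0.0642 * Real.log (3 * (T + h) / (2 * π))) +
        2 / π * (∫ t in T..T + h, lfunctionTheta χ t) - 2 * ∑ P ∈ Z₂, (T + h - P.2) <
        h * (2 * Z₁.card + 1)) :
    LFunctionRHUpTo χ T ∧ lfunctionZeroCount χ T = 2 * Z₁.card ∧
      lfunctionCriticalZeroCount χ T = 2 * Z₁.card :=
  LFunctionRHUpTo.of_turing_signChanges_mod3 trudgianCheck_eq_true hχ hT hh hZ₁ hZ₂ hZ₂T hnum

/-- **Conductor `4`, hypothesis-free** (`(−4/·)`; Table 5.5 `Q = 4`). [cite: Rumely1993ERH, Supplement Table 5.5 (Q = 4)] -/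
theorem LFunctionRHUpTo.of_turing_mod4 {χ : DirichletCharacter ℂ 4} (hχ : χ.IsPrimitive)
    {T h : ℝ} (hT : 50 < T) (hh : 0 < h)
    {Z₁ : Finset (ℝ × ℝ)} (hZ₁ : IsSignChangeData χ T Z₁)
    {Z₂ : Finset (ℝ × ℝ)} (hZ₂ : IsSignChangeData χ (T + h) Z₂) (hZ₂T : ∀ P ∈ Z₂, T < P.1)
    (hnum : 2 * (2.26 + 0.0642 * Real.log (4 * (T + h) / (2 * π))) +
        2 / π * (∫ t in T..T + h, lfunctionTheta χ t) - 2 * ∑ P ∈ Z₂, (T + h - P.2) <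
        h * (2 * Z₁.card + 1)) :
    LFunctionRHUpTo χ T ∧ lfunctionZeroCount χ T = 2 * Z₁.card ∧
      lfunctionCriticalZeroCount χ T = 2 * Z₁.card :=
  LFunctionRHUpTo.of_turing_signChanges_mod4 trudgianCheck_eq_true hχ hT hh hZ₁ hZ₂ hZ₂T hnum

/-- **Conductor `5`, hypothesis-free** (`(5/·)`; Table 5.5 `Q = 5, K = 3`). [cite: Rumely1993ERH, Supplement Table 5.5 (Q = 5, K = 3)] -/
theorem LFunctionRHUpTo.of_turing_mod5 {χ : DirichletCharacter ℂ 5} (hχ : χ.IsPrimitive)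
    (hχ2 : χ.IsQuadratic) {T h : ℝ} (hT : 50 < T) (hh : 0 < h)
    {Z₁ : Finset (ℝ × ℝ)} (hZ₁ : IsSignChangeData χ T Z₁)
    {Z₂ : Finset (ℝ × ℝ)} (hZ₂ : IsSignChangeData χ (T + h) Z₂) (hZ₂T : ∀ P ∈ Z₂, T < P.1)
    (hnum : 2 * (2.26 + 0.0642 * Real.log (5 * (T + h) / (2 * π))) +
        2 / π * (∫ t in T..T + h, lfunctionTheta χ t) - 2 * ∑ P ∈ Z₂, (T + h - P.2) <
        h * (2 * Z₁.card + 1)) :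
    LFunctionRHUpTo χ T ∧ lfunctionZeroCount χ T = 2 * Z₁.card ∧
      lfunctionCriticalZeroCount χ T = 2 * Z₁.card :=
  LFunctionRHUpTo.of_turing_signChanges_mod5 trudgianCheck_eq_true hχ hχ2 hT hh hZ₁ hZ₂ hZ₂T hnum

/-- **Conductor `7`, hypothesis-free** (`(−7/·)`; Table 5.5 `Q = 7, K = 5`). [cite: Rumely1993ERH, Supplement Table 5.5 (Q = 7, K = 5)] -/
theorem LFunctionRHUpTo.of_turing_mod7 {χ : DirichletCharacter ℂ 7} (hχ : χ.IsPrimitive)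
    (hχ2 : χ.IsQuadratic) {T h : ℝ} (hT : 50 < T) (hh : 0 < h)
    {Z₁ : Finset (ℝ × ℝ)} (hZ₁ : IsSignChangeData χ T Z₁)
    {Z₂ : Finset (ℝ × ℝ)} (hZ₂ : IsSignChangeData χ (T + h) Z₂) (hZ₂T : ∀ P ∈ Z₂, T < P.1)
    (hnum : 2 * (2.26 + 0.0642 * Real.log (7 * (T + h) / (2 * π))) +
        2 / π * (∫ t in T..T + h, lfunctionTheta χ t) - 2 * ∑ P ∈ Z₂, (T + h - P.2) <
        h * (2 * Z₁.card + 1)) :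
    LFunctionRHUpTo χ T ∧ lfunctionZeroCount χ T = 2 * Z₁.card ∧
      lfunctionCriticalZeroCount χ T = 2 * Z₁.card :=
  LFunctionRHUpTo.of_turing_signChanges_mod7 trudgianCheck_eq_true hχ hχ2 hT hh hZ₁ hZ₂ hZ₂T hnum

/-- **Conductor `8`, hypothesis-free** (`(±8/·)`; Table 5.5 `Q = 8`). [cite: Rumely1993ERH, Supplement Table 5.5 (Q = 8)] -/
theorem LFunctionRHUpTo.of_turing_mod8 {χ : DirichletCharacter ℂ 8} (hχ : χ.IsPrimitive)
    {T h : ℝ} (hT : 50 < T) (hh : 0 < h)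
    {Z₁ : Finset (ℝ × ℝ)} (hZ₁ : IsSignChangeData χ T Z₁)
    {Z₂ : Finset (ℝ × ℝ)} (hZ₂ : IsSignChangeData χ (T + h) Z₂) (hZ₂T : ∀ P ∈ Z₂, T < P.1)
    (hnum : 2 * (2.26 + 0.0642 * Real.log (8 * (T + h) / (2 * π))) +
        2 / π * (∫ t in T..T + h, lfunctionTheta χ t) - 2 * ∑ P ∈ Z₂, (T + h - P.2) <
        h * (2 * Z₁.card + 1)) :
    LFunctionRHUpTo χ T ∧ lfunctionZeroCount χ T = 2 * Z₁.card ∧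
      lfunctionCriticalZeroCount χ T = 2 * Z₁.card :=
  LFunctionRHUpTo.of_turing_signChanges_mod8 trudgianCheck_eq_true hχ hT hh hZ₁ hZ₂ hZ₂T hnum

end Literature.NumberTheory.LFunctions

end
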